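import Summits.BirchSwinnertonDyer.BirchSwinnertonDyer.Theorems.AlignedTransportAtTwoMainConjectureOfRankZeroBSDAtTwoFineRoadKleinCohomology
import HarnessLib

/-!
# Route `AlignedTransportAtTwo`, crux C2 `MainConjectureOfRankZeroBSDAtTwo` (stmt-BirchSwinnertonDyer-22298),
# road (b″): PERFECT DESCENT at `2`, part III — `H²(Q̄, V₄) = 0` as an EXTENSION theorem for crossed
# homomorphisms: the transversal lemma and the cases `Q̄ ∈ {1, C₂, C₃}`

Cell `bsd-f1-sign2`, WIDTH-5 attach seat `bsd-line-att-p3` (gen 4) on line `birth` of crux C2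
(`--supports` stmt-BirchSwinnertonDyer-22298; closes nothing). HONEST FRAMING: THEOREMS ONLY — no definition, no
named fact, no instance, no `sorry`; BSD is NOT proved by any of this. Sequel of `…FineRoadKleinCohomology`
(`H¹(Q̄, V₄) = 0`): the SURJECTIVE half of inflation–restriction for the Klein four-group of coefficients, as pure
algebra. Setting: a group `Q` acting on an additive group `M` with `#M = 4`, `m + m = 0`; `N ≤ Q` the kernel of
the action (`g ∈ N ↔ g` acts trivially); `φ : Q → M` a function which ON `N` is additive and `Q`-EQUIVARIANT
(`φ (g x g⁻¹) = g • φ x` for `x ∈ N`) — i.e. a `Q̄`-invariant class of `H¹(N, M) = Hom(N, M)`. GOAL: a crossed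
homomorphism `A : Q → M` (`A (g h) = A g + g • A h`) with `A|_N = φ|_N`. The obstruction lives in
`H²(Q̄, M)`, `Q̄ = Q/N ≤ Aut(M) ≅ S₃`, which vanishes because `M` is `𝔽₂[S₃]`-projective
(PERFECT-DESCENT.md §2–§3 (ii), lead att-p2 g4).

## What is proved

* §1 **`crossedHom_of_transversal`** (any group `Q`, any `Q`-module `M`, `N ⊴ Q` acting trivially, `φ` additive
  and equivariant on `N`): for a map `r : Q → Q` with `r(g)⁻¹ g ∈ N` and a correction `a : Q → M` satisfying the
  FACTOR-SET EQUATION `a (g g') = a g + g • a g' - (g · r g') • φ (r(g g')⁻¹ r(g) r(g'))`, the function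
  `A g := a g + g • φ (r(g)⁻¹ g)` is a crossed homomorphism; `factor_mem` (`r(gg')⁻¹ r(g) r(g') ∈ N`);
  `transversal_extension_restrict` (`A|_N = φ` when `r = 1`, `a = 0` on `N`).
* §2 **`transposition_shape`** (no fixed-point-free element, some non-trivial one): all non-trivial elements act as
  ONE transposition `q₀` (`q₀ a₀ = a₀`, `q₀ b = a₀ + b`).
* §3 **`exists_crossedHom_extension_of_no_fpf`** (`Q̄ ∈ {1, C₂}`): `r ∈ {1, q₀}`, `a ∈ {0, m₀}` with
  `m₀ + q₀ • m₀ = φ(q₀²)` — solvable because `φ(q₀²) ∈ M^{q₀} = {0, a₀} = (1 + q₀)M` (`M|_{⟨q₀⟩}` is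
  `𝔽₂[C₂]`-free: `H²(C₂, M) = 0`).
* §4 **`exists_crossedHom_extension_of_fpf_of_no_transposition`** (`Q̄ = C₃ = ⟨σ̄⟩`, `σ` fixed-point-free, every
  element trivial or fixed-point-free): `r ∈ {1, σ, σ²}`, `a = 0`; every factor `r(gg')⁻¹ r(g) r(g')` lies in `N`
  and COMMUTES with `σ`, so its `φ`-value is `σ`-fixed, hence `0` (`H²(C₃, M) = 0`, `3 ∈ 𝔽₂ˣ`).

The case `Q̄ = S₃` (extend over the index-`2` subgroup of trivial-or-fixed-point-free elements by §4, then across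
index `2` using `M^{C₃} = 0` and part I) and the Galois packaging (`res` ONTO the invariants) are the sequels.

References: Serre, *Galois Cohomology*, I §2.6 (b), I §5.1; Brown, *Cohomology of Groups*, IV.3 (factor sets), VI.8.
-/

set_option autoImplicit false
-- the Theorems namespace of this sub repeats the summit name by design (D-0017 nested layout)
set_option linter.dupNamespace false

namespace Summit.BirchSwinnertonDyer.BirchSwinnertonDyer.Theorems.AlignedTransportAtTwoFineRoad.PerfectDescent

open Summit.BirchSwinnertonDyer.BirchSwinnertonDyer.Theorems.MultTransportAtTwo

variable {Q : Type*} [Group Q] {M : Type*} [AddCommGroup M] [DistribMulAction Q M]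

/-! ## §1 The transversal lemma: crossed homomorphisms from a factor-set solution -/

section Transversal

/-- The FACTOR `r(gg')⁻¹ r(g) r(g')` of a map `r : Q → Q` with `r(g)⁻¹ g ∈ N` (a transversal up to `N`) lies in the
normal subgroup `N`. [cite: SerreGaloisCohomology1997, I §5.1] -/
theorem factor_mem (N : Subgroup Q) (hNnorm : ∀ (g : Q), ∀ n ∈ N, g * n * g⁻¹ ∈ N) (r : Q → Q)
    (hr : ∀ g : Q, (r g)⁻¹ * g ∈ N) (g g' : Q) : (r (g * g'))⁻¹ * r g * r g' ∈ N := by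
  have hc : (r g')⁻¹ * ((r g)⁻¹ * g) * r g' ∈ N := by
    have h := hNnorm (r g')⁻¹ _ (hr g)
    rwa [inv_inv] at h
  have e : (r (g * g'))⁻¹ * r g * r g' =
      ((r (g * g'))⁻¹ * (g * g')) * ((r g')⁻¹ * g')⁻¹ * ((r g')⁻¹ * ((r g)⁻¹ * g) * r g')⁻¹ := by group
  rw [e]
  exact N.mul_mem (N.mul_mem (hr _) (N.inv_mem (hr g'))) (N.inv_mem hc)

/-- **The transversal lemma.** Let `N ≤ Q` be a normal subgroup acting trivially on the `Q`-module `M`,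
`φ : Q → M` additive on `N` and `Q`-equivariant on `N` (`φ (g x g⁻¹) = g • φ x`), `r : Q → Q` with `r(g)⁻¹ g ∈ N`,
and `a : Q → M` a solution of the factor-set equation
`a (g g') = a g + g • a g' - (g · r g') • φ (r(gg')⁻¹ r(g) r(g'))`. Then `A g := a g + g • φ (r(g)⁻¹ g)` is a
crossed homomorphism: `A (g g') = A g + g • A g'`. (The `2`-cochain `(g, g') ↦ (g r g') • φ(r(gg')⁻¹ r g r g')` is
the transgression of `φ`; `a` is a cochain bounding it.) [cite: SerreGaloisCohomology1997, I §2.6 (b) and I §5.1] -/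
theorem crossedHom_of_transversal (N : Subgroup Q) (hNtriv : ∀ n ∈ N, ∀ m : M, n • m = m)
    (hNnorm : ∀ (g : Q), ∀ n ∈ N, g * n * g⁻¹ ∈ N) (φ : Q → M)
    (hφ : ∀ x ∈ N, ∀ y ∈ N, φ (x * y) = φ x + φ y) (hφeq : ∀ (g : Q), ∀ x ∈ N, φ (g * x * g⁻¹) = g • φ x)
    (r : Q → Q) (hr : ∀ g : Q, (r g)⁻¹ * g ∈ N) (a : Q → M)
    (hfac : ∀ g g' : Q,
      a (g * g') = a g + g • a g' - (g * r g') • φ ((r (g * g'))⁻¹ * r g * r g')) (g g' : Q) :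
    a (g * g') + (g * g') • φ ((r (g * g'))⁻¹ * (g * g')) =
      (a g + g • φ ((r g)⁻¹ * g)) + g • (a g' + g' • φ ((r g')⁻¹ * g')) := by
  have hn : (r g)⁻¹ * g ∈ N := hr g
  have hn' : (r g')⁻¹ * g' ∈ N := hr g'
  have hc : (r g')⁻¹ * ((r g)⁻¹ * g) * r g' ∈ N := by
    have h := hNnorm (r g')⁻¹ _ hn
    rwa [inv_inv] at h
  have hf : (r (g * g'))⁻¹ * r g * r g' ∈ N := factor_mem N hNnorm r hr g g'
  have e1 : (r (g * g'))⁻¹ * (g * g') =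
      ((r (g * g'))⁻¹ * r g * r g') * ((r g')⁻¹ * ((r g)⁻¹ * g) * r g') * ((r g')⁻¹ * g') := by group
  have e2 : φ ((r (g * g'))⁻¹ * (g * g')) =
      φ ((r (g * g'))⁻¹ * r g * r g') + φ ((r g')⁻¹ * ((r g)⁻¹ * g) * r g') + φ ((r g')⁻¹ * g') := by
    rw [e1, hφ _ (N.mul_mem hf hc) _ hn', hφ _ hf _ hc]
  have e3 : φ ((r g')⁻¹ * ((r g)⁻¹ * g) * r g') = (r g')⁻¹ • φ ((r g)⁻¹ * g) := by
    have h := hφeq (r g')⁻¹ _ hn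
    rwa [inv_inv] at h
  have e4 : ∀ m : M, (g * g') • m = (g * r g') • m := fun m ↦ by
    conv_lhs => rw [show g * g' = g * r g' * ((r g')⁻¹ * g') by group, mul_smul (g * r g'), hNtriv _ hn']
  have e5 : (g * r g') • φ ((r g')⁻¹ * g') = g • (g' • φ ((r g')⁻¹ * g')) := by rw [← mul_smul, e4]
  rw [e4, e2, smul_add, smul_add, e3, smul_smul (g * r g') (r g')⁻¹, mul_inv_cancel_right, hfac g g', e5,
    smul_add]
  abel

/-- The function of the transversal lemma RESTRICTS to `φ` on `N` when `r = 1` and `a = 0` on `N`.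
[cite: SerreGaloisCohomology1997, I §5.1] -/
theorem transversal_extension_restrict (N : Subgroup Q) (hNtriv : ∀ n ∈ N, ∀ m : M, n • m = m) (φ : Q → M)
    (r : Q → Q) (a : Q → M) (hr1 : ∀ n ∈ N, r n = 1) (ha1 : ∀ n ∈ N, a n = 0) (n : Q) (hn : n ∈ N) :
    a n + n • φ ((r n)⁻¹ * n) = φ n := by
  rw [ha1 n hn, hr1 n hn, inv_one, one_mul, hNtriv n hn, zero_add]

/-- **Existence of an extension from transversal data**: with `N, φ, r, a` as in `crossedHom_of_transversal` and
`r = 1`, `a = 0` on `N`, there is a crossed homomorphism `A : Q → M` with `A|_N = φ|_N`.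
[cite: SerreGaloisCohomology1997, I §2.6 (b)] -/
theorem exists_crossedHom_extension_of_transversal (N : Subgroup Q) (hNtriv : ∀ n ∈ N, ∀ m : M, n • m = m)
    (hNnorm : ∀ (g : Q), ∀ n ∈ N, g * n * g⁻¹ ∈ N) (φ : Q → M)
    (hφ : ∀ x ∈ N, ∀ y ∈ N, φ (x * y) = φ x + φ y) (hφeq : ∀ (g : Q), ∀ x ∈ N, φ (g * x * g⁻¹) = g • φ x)
    (r : Q → Q) (hr : ∀ g : Q, (r g)⁻¹ * g ∈ N) (hr1 : ∀ n ∈ N, r n = 1) (a : Q → M)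
    (ha1 : ∀ n ∈ N, a n = 0)
    (hfac : ∀ g g' : Q,
      a (g * g') = a g + g • a g' - (g * r g') • φ ((r (g * g'))⁻¹ * r g * r g')) :
    ∃ A : Q → M, (∀ g h : Q, A (g * h) = A g + g • A h) ∧ ∀ n ∈ N, A n = φ n :=
  ⟨fun g ↦ a g + g • φ ((r g)⁻¹ * g),
    fun g h ↦ crossedHom_of_transversal N hNtriv hNnorm φ hφ hφeq r hr a hfac g h,
    fun n hn ↦ transversal_extension_restrict N hNtriv φ r a hr1 ha1 n hn⟩

/-- The kernel of an action is normal: if `n` acts trivially so does `g n g⁻¹`. [folklore] -/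
theorem conj_smul_eq_self_of_smul_eq_self {n : Q} (hn : ∀ m : M, n • m = m) (g : Q) (m : M) :
    (g * n * g⁻¹) • m = m := by
  rw [mul_smul, mul_smul, hn, smul_inv_smul]

omit [DistribMulAction Q M] in
/-- `φ 1 = 0` for `φ` additive on `N`. [folklore] -/
theorem map_one_of_additiveOn (N : Subgroup Q) (φ : Q → M) (hφ : ∀ x ∈ N, ∀ y ∈ N, φ (x * y) = φ x + φ y) :
    φ 1 = 0 := by
  have h := hφ 1 N.one_mem 1 N.one_mem
  rw [mul_one] at h
  exact left_eq_add.mp h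

end Transversal

/-! ## §2 The shape `Q̄ = C₂`: all non-trivial elements act as one transposition -/

section Transposition

/-- **Transposition shape.** If no element of `Q` acts without non-zero fixed point and `q₀` moves `b`, then there
is `a₀` with `M = {0, a₀, b, a₀ + b}`, `q₀ a₀ = a₀`, `q₀ b = a₀ + b`, `q₀ (a₀ + b) = b`, and EVERY element of `Q`
acts trivially or as `q₀` (two distinct transpositions of the three non-zero elements would compose to a `3`-cycle,
which is fixed-point-free). [folklore] -/
theorem transposition_shape (h4 : Nat.card M = 4) (h2 : ∀ m : M, m + m = 0)
    (hB : ∀ σ : Q, ∃ m : M, σ • m = m ∧ m ≠ 0) {q₀ : Q} {b : M} (hb : q₀ • b ≠ b) :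
    ∃ a₀ : M, a₀ ≠ 0 ∧ b ≠ 0 ∧ a₀ ≠ b ∧ q₀ • a₀ = a₀ ∧ q₀ • b = a₀ + b ∧ q₀ • (a₀ + b) = b ∧
      ∀ q : Q, (∀ m : M, q • m = m) ∨ (∀ m : M, q • m = q₀ • m) := by
  obtain ⟨a₀, ha₀q, ha₀⟩ := hB q₀
  have hb0 : b ≠ 0 := fun h ↦ hb (by rw [h, smul_zero])
  have hba : a₀ ≠ b := fun h ↦ hb (by rw [← h, ha₀q])
  have hq₀b : q₀ • b = a₀ + b := by
    rcases klein_cases h4 h2 ha₀ hb0 hba (q₀ • b) with h | h | h | h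
    · exact absurd ((smul_eq_zero_iff_eq q₀).mp h) hb0
    · rw [← ha₀q] at h
      exact absurd (smul_left_cancel q₀ h) hba.symm
    · exact absurd h hb
    · exact h
  have hq₀ab : q₀ • (a₀ + b) = b := by rw [smul_add, ha₀q, hq₀b, ← add_assoc, h2, zero_add]
  refine ⟨a₀, ha₀, hb0, hba, ha₀q, hq₀b, hq₀ab, fun q ↦ ?_⟩
  by_cases hq : ∀ m : M, q • m = m
  · exact Or.inl hq
  right
  obtain ⟨a₁, ha₁q, ha₁⟩ := hB q
  suffices hgen : q • a₀ = a₀ ∧ q • b = a₀ + b by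
    intro m
    exact smul_eq_smul_of_generators h4 h2 ha₀ hb0 hba (by rw [hgen.1, ha₀q]) (by rw [hgen.2, hq₀b]) m
  rcases klein_cases h4 h2 ha₀ hb0 hba a₁ with h | h | h | h
  · exact absurd h ha₁
  · rw [h] at ha₁q
    refine ⟨ha₁q, ?_⟩
    rcases klein_cases h4 h2 ha₀ hb0 hba (q • b) with e | e | e | e
    · exact absurd ((smul_eq_zero_iff_eq q).mp e) hb0
    · rw [← ha₁q] at e
      exact absurd (smul_left_cancel q e) hba.symm
    · exact absurd (smul_eq_self_of_generators h4 h2 ha₀ hb0 hba ha₁q e) hq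
    · exact e
  · exfalso
    rw [h] at ha₁q
    have hqa : q • a₀ = a₀ + b := by
      rcases klein_cases h4 h2 ha₀ hb0 hba (q • a₀) with e | e | e | e
      · exact absurd ((smul_eq_zero_iff_eq q).mp e) ha₀
      · exact absurd (smul_eq_self_of_generators h4 h2 ha₀ hb0 hba e ha₁q) hq
      · rw [← ha₁q] at e
        exact absurd (smul_left_cancel q e) hba
      · exact e
    have hqab : q • (a₀ + b) = a₀ := by rw [smul_add, hqa, ha₁q, add_assoc, h2, add_zero]
    obtain ⟨m₁, hm₁q, hm₁⟩ := hB (q₀ * q)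
    rw [mul_smul] at hm₁q
    rcases klein_cases h4 h2 ha₀ hb0 hba m₁ with e | e | e | e
    · exact hm₁ e
    · rw [e, hqa, hq₀ab] at hm₁q
      exact hba hm₁q.symm
    · rw [e, ha₁q, hq₀b] at hm₁q
      exact ha₀ (by simpa using hm₁q)
    · rw [e, hqab, ha₀q] at hm₁q
      exact hb0 (by simpa using hm₁q.symm)
  · exfalso
    rw [h] at ha₁q
    have hbab : b = a₀ + (a₀ + b) := by rw [← add_assoc, h2, zero_add]
    have hqa : q • a₀ = b := by
      rcases klein_cases h4 h2 ha₀ hb0 hba (q • a₀) with e | e | e | e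
      · exact absurd ((smul_eq_zero_iff_eq q).mp e) ha₀
      · exfalso
        apply hq
        have hqb : q • b = b := by
          conv_lhs => rw [hbab]
          rw [smul_add, e, ha₁q, ← hbab]
        exact smul_eq_self_of_generators h4 h2 ha₀ hb0 hba e hqb
      · exact e
      · rw [← ha₁q] at e
        have e' := smul_left_cancel q e
        exact absurd (by simpa using e'.symm) hb0
    have hqb : q • b = a₀ := by
      conv_lhs => rw [hbab]
      rw [smul_add, hqa, ha₁q, add_left_comm, h2, add_zero]
    obtain ⟨m₁, hm₁q, hm₁⟩ := hB (q₀ * q)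
    rw [mul_smul] at hm₁q
    rcases klein_cases h4 h2 ha₀ hb0 hba m₁ with e | e | e | e
    · exact hm₁ e
    · rw [e, hqa, hq₀b] at hm₁q
      exact hb0 (by simpa using hm₁q)
    · rw [e, hqb, ha₀q] at hm₁q
      exact hba hm₁q
    · rw [e, ha₁q, hq₀ab] at hm₁q
      exact ha₀ (by simpa using hm₁q.symm)

end Transposition

/-! ## §3 Extension when `Q̄ ∈ {1, C₂}` (no fixed-point-free element): `H²(C₂, V₄) = 0` -/

section NoFpf

/-- **Extension across `Q̄ ∈ {1, C₂}`.** Let `Q` act on the Klein four-group `M` WITHOUT fixed-point-free element,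
`N` = the kernel of the action, `φ : Q → M` additive and `Q`-equivariant on `N`. Then some crossed homomorphism
`A : Q → M` restricts to `φ` on `N`. (If all of `Q` acts trivially, `A = φ`. Otherwise every non-trivial element
acts as one transposition `q₀` (`transposition_shape`); `φ(q₀²) ∈ M^{q₀} = {0, a₀}` by equivariance, and
`M^{q₀} = (1 + q₀)M` — take `r ∈ {1, q₀}`, `a ∈ {0, m₀}` with `m₀ + q₀ m₀ = φ(q₀²)` in the transversal lemma.)
[cite: SerreGaloisCohomology1997, I §2.6 (b)] -/
theorem exists_crossedHom_extension_of_no_fpf (h4 : Nat.card M = 4) (h2 : ∀ m : M, m + m = 0)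
    (N : Subgroup Q) (hN : ∀ g : Q, g ∈ N ↔ ∀ m : M, g • m = m)
    (hB : ∀ σ : Q, ∃ m : M, σ • m = m ∧ m ≠ 0) (φ : Q → M)
    (hφ : ∀ x ∈ N, ∀ y ∈ N, φ (x * y) = φ x + φ y) (hφeq : ∀ (g : Q), ∀ x ∈ N, φ (g * x * g⁻¹) = g • φ x) :
    ∃ A : Q → M, (∀ g h : Q, A (g * h) = A g + g • A h) ∧ ∀ n ∈ N, A n = φ n := by
  have hNtriv : ∀ n ∈ N, ∀ m : M, n • m = m := fun n hn ↦ (hN n).mp hn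
  have hNnorm : ∀ (g : Q), ∀ n ∈ N, g * n * g⁻¹ ∈ N := fun g n hn ↦
    (hN _).mpr (conj_smul_eq_self_of_smul_eq_self (hNtriv n hn) g)
  have hφ1 : φ 1 = 0 := map_one_of_additiveOn N φ hφ
  by_cases htriv : ∀ g : Q, ∀ m : M, g • m = m
  · -- `Q̄ = 1`: `A = φ`
    refine ⟨φ, fun g h ↦ ?_, fun n _ ↦ rfl⟩
    rw [hφ g ((hN g).mpr (htriv g)) h ((hN h).mpr (htriv h)), htriv g]
  push Not at htriv
  obtain ⟨q₀, b, hb⟩ := htriv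
  obtain ⟨a₀, ha₀, hb0, hba, ha₀q, hq₀b, hq₀ab, hC⟩ := transposition_shape h4 h2 hB hb
  have hq₀N : q₀ ∉ N := fun h ↦ hb (hNtriv q₀ h b)
  -- `q₀²` acts trivially and `φ(q₀²) ∈ M^{q₀} = {0, a₀}`
  have hq₀q₀ : q₀ * q₀ ∈ N := (hN _).mpr
    (smul_eq_self_of_generators h4 h2 ha₀ hb0 hba (by rw [mul_smul, ha₀q, ha₀q]) (by rw [mul_smul, hq₀b, hq₀ab]))
  have hx : q₀ • φ (q₀ * q₀) = φ (q₀ * q₀) := by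
    rw [← hφeq q₀ _ hq₀q₀, show q₀ * (q₀ * q₀) * q₀⁻¹ = q₀ * q₀ by group]
  have hx' : φ (q₀ * q₀) = 0 ∨ φ (q₀ * q₀) = a₀ := by
    rcases klein_cases h4 h2 ha₀ hb0 hba (φ (q₀ * q₀)) with e | e | e | e
    · exact Or.inl e
    · exact Or.inr e
    · exfalso; rw [e, hq₀b] at hx; exact ha₀ (by simpa using hx)
    · exfalso; rw [e, hq₀ab] at hx; exact ha₀ (by simpa using hx.symm)
  -- the bounding cochain value `m₀` with `m₀ + q₀ • m₀ = φ(q₀²)`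
  obtain ⟨m₀, hm₀⟩ : ∃ m₀ : M, m₀ + q₀ • m₀ = φ (q₀ * q₀) := by
    rcases hx' with e | e
    · exact ⟨0, by rw [smul_zero, add_zero, e]⟩
    · exact ⟨b, by rw [hq₀b, ← add_assoc, add_comm b a₀, add_assoc, h2, add_zero, e]⟩
  -- transversal `r ∈ {1, q₀}` and cochain `a ∈ {0, m₀}`
  classical
  let r : Q → Q := fun g ↦ if g ∈ N then 1 else q₀
  let a : Q → M := fun g ↦ if g ∈ N then 0 else m₀
  have hrN : ∀ g ∈ N, r g = 1 := fun g hg ↦ if_pos hg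
  have hrN' : ∀ g ∉ N, r g = q₀ := fun g hg ↦ if_neg hg
  have haN : ∀ g ∈ N, a g = 0 := fun g hg ↦ if_pos hg
  have haN' : ∀ g ∉ N, a g = m₀ := fun g hg ↦ if_neg hg
  -- elements outside `N` act as `q₀`
  have hout : ∀ g ∉ N, ∀ m : M, g • m = q₀ • m := fun g hg ↦
    (hC g).resolve_left fun h ↦ hg ((hN g).mpr h)
  have hr : ∀ g : Q, (r g)⁻¹ * g ∈ N := by
    intro g
    by_cases hg : g ∈ N
    · rw [hrN g hg, inv_one, one_mul]; exact hg
    · rw [hrN' g hg]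
      exact (hN _).mpr fun m ↦ by rw [mul_smul, hout g hg, inv_smul_smul]
  -- product rule for membership in `N`
  have hmulN : ∀ g g' : Q, (g * g' ∈ N ↔ (g ∈ N ↔ g' ∈ N)) := by
    intro g g'
    by_cases hg : g ∈ N <;> by_cases hg' : g' ∈ N
    · exact iff_of_true (N.mul_mem hg hg') (iff_of_true hg hg')
    · refine iff_of_false (fun h ↦ hg' ?_) (fun h ↦ hg' (h.mp hg))
      have h' := N.mul_mem (N.inv_mem hg) h
      rwa [inv_mul_cancel_left] at h'
    · refine iff_of_false (fun h ↦ hg ?_) (fun h ↦ hg (h.mpr hg'))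
      have h' := N.mul_mem h (N.inv_mem hg')
      rwa [mul_inv_cancel_right] at h'
    · refine iff_of_true ((hN _).mpr fun m ↦ ?_) (iff_of_false hg hg')
      rw [mul_smul, hout g' hg', hout g hg, ← mul_smul]
      exact hNtriv _ hq₀q₀ m
  refine exists_crossedHom_extension_of_transversal N hNtriv hNnorm φ hφ hφeq r hr hrN a haN ?_
  intro g g'
  by_cases hg : g ∈ N <;> by_cases hg' : g' ∈ N
  · have hgg' : g * g' ∈ N := (hmulN g g').mpr (iff_of_true hg hg')
    rw [haN _ hgg', haN g hg, haN g' hg', hrN _ hgg', hrN g hg, hrN g' hg']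
    simp only [inv_one, mul_one, hφ1, smul_zero, add_zero, sub_zero]
  · have hgg' : g * g' ∉ N := fun h ↦ hg' (((hmulN g g').mp h).mp hg)
    rw [haN' _ hgg', haN g hg, haN' g' hg', hrN' _ hgg', hrN g hg, hrN' g' hg']
    simp only [mul_one, inv_mul_cancel, hφ1, smul_zero, sub_zero, zero_add, hNtriv g hg]
  · have hgg' : g * g' ∉ N := fun h ↦ hg (((hmulN g g').mp h).mpr hg')
    rw [haN' _ hgg', haN' g hg, haN g' hg', hrN' _ hgg', hrN' g hg, hrN g' hg']
    simp only [mul_one, inv_mul_cancel, hφ1, smul_zero, add_zero, sub_zero]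
  · have hgg' : g * g' ∈ N := (hmulN g g').mpr (iff_of_false hg hg')
    have htriv' : ∀ m : M, (g * q₀) • m = m := fun m ↦ by
      rw [mul_smul, hout g hg, ← mul_smul]; exact hNtriv _ hq₀q₀ m
    rw [haN _ hgg', haN' g hg, haN' g' hg', hrN _ hgg', hrN' g hg, hrN' g' hg', inv_one, one_mul, htriv',
      hout g hg m₀, hm₀, sub_self]

end NoFpf

/-! ## §4 Extension when `Q̄ = C₃` (a fixed-point-free element, no transposition): `H²(C₃, V₄) = 0` -/

section Cyclic3

/-- `σ³` acts trivially for a fixed-point-free `σ` on the Klein four-group (`σ` is a `3`-cycle). [folklore] -/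
theorem smul_smul_smul_eq_self_of_fpf (h4 : Nat.card M = 4) (h2 : ∀ m : M, m + m = 0) {σ : Q}
    (hσ : ∀ m : M, σ • m = m → m = 0) (m : M) : σ • (σ • (σ • m)) = m := by
  rw [smul_smul_eq_add_of_fpf h4 h2 hσ, smul_smul_eq_add_of_fpf h4 h2 hσ, add_left_comm, h2, add_zero]

/-- An `N`-valued element commuting with a fixed-point-free `σ` has `φ`-value `0`: `φ(f) = φ(σ f σ⁻¹) = σ • φ(f)`
is `σ`-fixed. [folklore] -/
theorem map_eq_zero_of_commute_fpf (N : Subgroup Q) (φ : Q → M)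
    (hφeq : ∀ (g : Q), ∀ x ∈ N, φ (g * x * g⁻¹) = g • φ x) {σ : Q} (hσ : ∀ m : M, σ • m = m → m = 0)
    {f : Q} (hf : f ∈ N) (hcomm : σ * f = f * σ) : φ f = 0 := by
  apply hσ
  rw [← hφeq σ f hf, hcomm, mul_inv_cancel_right]

/-- **Extension across `Q̄ = C₃`.** Let `Q` act on the Klein four-group `M` with a fixed-point-free element `σ` and
such that EVERY element acts trivially or without non-zero fixed point (no transposition), `N` = the kernel of the
action, `φ : Q → M` additive and `Q`-equivariant on `N`. Then some crossed homomorphism `A : Q → M` restricts to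
`φ` on `N`: transversal `r ∈ {1, σ, σ²}` (every element acts as `1`, `σ` or `σ²`, `fpf_smul_dichotomy`), cochain
`a = 0`; each factor `r(gg')⁻¹ r(g) r(g')` lies in `N` and commutes with `σ`, so `φ` kills it
(`map_eq_zero_of_commute_fpf`). [cite: SerreGaloisCohomology1997, I §2.6 (b)] -/
theorem exists_crossedHom_extension_of_fpf_of_no_transposition (h4 : Nat.card M = 4)
    (h2 : ∀ m : M, m + m = 0) (N : Subgroup Q) (hN : ∀ g : Q, g ∈ N ↔ ∀ m : M, g • m = m) {σ : Q}
    (hσ : ∀ m : M, σ • m = m → m = 0)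
    (hnoT : ∀ g : Q, (∀ m : M, g • m = m) ∨ (∀ m : M, g • m = m → m = 0)) (φ : Q → M)
    (hφ : ∀ x ∈ N, ∀ y ∈ N, φ (x * y) = φ x + φ y) (hφeq : ∀ (g : Q), ∀ x ∈ N, φ (g * x * g⁻¹) = g • φ x) :
    ∃ A : Q → M, (∀ g h : Q, A (g * h) = A g + g • A h) ∧ ∀ n ∈ N, A n = φ n := by
  have hNtriv : ∀ n ∈ N, ∀ m : M, n • m = m := fun n hn ↦ (hN n).mp hn
  have hNnorm : ∀ (g : Q), ∀ n ∈ N, g * n * g⁻¹ ∈ N := fun g n hn ↦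
    (hN _).mpr (conj_smul_eq_self_of_smul_eq_self (hNtriv n hn) g)
  classical
  -- transversal `r ∈ {1, σ, σ * σ}`
  let r : Q → Q := fun g ↦ if g ∈ N then 1 else if (∀ m : M, g • m = σ • m) then σ else σ * σ
  have hrN : ∀ g ∈ N, r g = 1 := fun g hg ↦ if_pos hg
  have hr1 : ∀ g ∉ N, (∀ m : M, g • m = σ • m) → r g = σ := fun g hg h ↦ by
    simp only [r, if_neg hg, if_pos h]
  have hr2 : ∀ g ∉ N, (¬ ∀ m : M, g • m = σ • m) → r g = σ * σ := fun g hg h ↦ by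
    simp only [r, if_neg hg, if_neg h]
  -- every `r g` commutes with `σ`
  have hcomm' : ∀ g : Q, σ * r g = r g * σ := by
    intro g
    by_cases hg : g ∈ N
    · rw [hrN g hg, mul_one, one_mul]
    · by_cases h : ∀ m : M, g • m = σ • m
      · rw [hr1 g hg h]
      · rw [hr2 g hg h, mul_assoc]
  have hcomm : ∀ g : Q, Commute σ (r g) := fun g ↦ hcomm' g
  -- `r g` represents `g` modulo `N`
  have hr : ∀ g : Q, (r g)⁻¹ * g ∈ N := by
    intro g
    by_cases hg : g ∈ N
    · rw [hrN g hg, inv_one, one_mul]; exact hg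
    · have hgfpf : ∀ m : M, g • m = m → m = 0 := (hnoT g).resolve_left fun h ↦ hg ((hN g).mpr h)
      by_cases h : ∀ m : M, g • m = σ • m
      · rw [hr1 g hg h]
        exact (hN _).mpr fun m ↦ by rw [mul_smul, h, inv_smul_smul]
      · rw [hr2 g hg h]
        have h' : ∀ m : M, g • m = σ • (σ • m) := (fpf_smul_dichotomy h4 h2 hσ hgfpf).resolve_left h
        exact (hN _).mpr fun m ↦ by rw [mul_smul, h', mul_inv_rev, mul_smul, inv_smul_smul, inv_smul_smul]
  refine exists_crossedHom_extension_of_transversal N hNtriv hNnorm φ hφ hφeq r hr hrN (fun _ ↦ 0)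
    (fun _ _ ↦ rfl) fun g g' ↦ ?_
  -- the factor commutes with `σ`, hence is killed by `φ`
  have hfcomm : Commute σ ((r (g * g'))⁻¹ * r g * r g') :=
    (((hcomm (g * g')).inv_right).mul_right (hcomm g)).mul_right (hcomm g')
  simp only [map_eq_zero_of_commute_fpf N φ hφeq hσ (factor_mem N hNnorm r hr g g') hfcomm.eq, smul_zero,
    add_zero, sub_zero]

end Cyclic3

end Summit.BirchSwinnertonDyer.BirchSwinnertonDyer.Theorems.AlignedTransportAtTwoFineRoad.PerfectDescent
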